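import Summits.QuantumFields.GaugeBoot.ClassBBootstrapSoundnessZd
import Summits.QuantumFields.GaugeBoot.ClassBNegativeCouplingEmpty
import HarnessLib

/-!
# The complete Kazakov–Zheng infinite-lattice SDP converges to exactly the Class-B states — and is infeasible at large levels wherever Class B is empty (gauge-boot, L3(α) ↔ L1/L4)

HONEST FRAMING (cell `pub-gaugeboot`, page 1 of every file): the venture produces certified bounds
on lattice expectations at stated coupling, gauge group, dimension and torus size; NOT a mass gap,
NOT a continuum limit, NOT a string tension; NOT Yang–Mills-summit-bearing (barriers
`FixedCouplingUltralocality`, `PerturbativeInvisibility`). Structural; it certifies no number.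

## Content (`SU(N)` on `ℤ^d`, one-link Wilson boundary actions, any real `β`)

`ClassBBootstrapSoundnessZd`: every Class-B state (`ClassB.lean`: `ℤ^d ⋊ B_d`-invariant, one-link
Gibbs, reflection positive for the site, link AND diagonal mirrors) is feasible for the COMPLETE KZ
SDP `kzLevelValuesZdSuN` at every level. Here the converse limit statement and its consequence:

* `kzCutObservablesZd N n` (all three families of cut observables), `ClassBState.ofProperties` (a
  Class-B state assembled from a DLR state with the invariances and the three RP properties);
* ★★★ `kzBootstrap_convergence_classB_suN` — for every polynomial `P` and `ε > 0`, for `n` large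
  every value of the complete level-`n` SDP lies within `ε` of `∫ P dω.μ` for some CLASS-B STATE `ω`
  (constrained cluster point ⟶ DLR state ⟶ invariances from polynomial moments ⟶ RP of all three
  families from the polynomial cuts, `IsReflectionPositiveFor.of_wordSpace`, the diagonal reflections
  being measure preserving by permutation invariance); ★★★ `kzLevelValuesZd_hausdorff_suN` — with
  soundness: THE COMPLETE KZ HIERARCHY CONVERGES TO EXACTLY THE RANGE OF `P` OVER THE CLASS-B STATES;
* ★★★ `kzLevelValuesZd_eventually_empty_of_isEmpty` — IF CLASS B IS EMPTY AT `β`, THE COMPLETE KZ SDP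
  IS INFEASIBLE AT ALL LARGE LEVELS (for every objective); ★★★
  `kzLevelValuesZd_eventually_empty_of_neg_suN` — `SU(N)`, `N ≥ 2`, `d ≥ 2`, `β < 0`: Class B is empty
  (`isEmpty_classBState_of_neg_suN`: translation invariance + one-link Gibbs + diagonal RP are
  incompatible at negative coupling), so Kazakov–Zheng's complete SDP with the diagonal RP cuts has NO
  feasible point at any sufficiently high level — the finite-level, infinite-lattice form of the
  lane's negative-coupling no-go (`DiagonalRPTorusNegative`, `ClassBNegativeCoupling*`).

What this is NOT: a bound on the level from which infeasibility sets in; anything at `β ≥ 0` beyond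
convergence (there Class-B inhabitation = the open `TorusLimitPointsDiagonalRP` outside uniqueness);
numbers.

References: V. Kazakov, Z. Zheng, arXiv:2203.11360 §3, arXiv:2404.16925 §3.2; K. Osterwalder,
E. Seiler, Ann. Phys. 110 (1978) 440. Folklore.
-/

noncomputable section

open MeasureTheory Filter Topology
open scoped ComplexOrder
open Literature.MathematicalPhysics.QuantumFieldTheory (LatticeRep)
open Literature.Probability.LatticeModels (Site)
open Literature.MathematicalPhysics.QuantumLattice

namespace Summit.QuantumFields.GaugeBoot

section ZdSuN

variable {d : ℕ} (N : ℕ) (β : ℝ)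

/-- **All three families of cut observables at degree `n`.** -/
def kzCutObservablesZd (n : ℕ) : Set C(LGConfig d (Matrix.specialUnitaryGroup (Fin N) ℂ), ℝ) :=
  rpCutObservablesZd (d := d) N n ∪
    {b | ∃ (i j : Fin d) (_ : i ≠ j) (F : C(LGConfig d (Matrix.specialUnitaryGroup (Fin N) ℂ), ℝ)),
      F ∈ wordSpace (fundamentalLatticeRep N) (diagHalfEdges i j) n ∧
        F.comp (zdDiagSwapCM (G := Matrix.specialUnitaryGroup (Fin N) ℂ) i j) * F = b}

/-- All of them. -/
def kzCutObservablesZdAll (d N : ℕ) : Set C(LGConfig d (Matrix.specialUnitaryGroup (Fin N) ℂ), ℝ) :=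
  ⋃ n, kzCutObservablesZd (d := d) N n

/-- Monotone in the degree. -/
theorem kzCutObservablesZd_mono {m n : ℕ} (hmn : m ≤ n) :
    kzCutObservablesZd (d := d) N m ⊆ kzCutObservablesZd (d := d) N n := by
  rintro b (hb | ⟨i, j, hij, F, hF, rfl⟩)
  · exact Or.inl (rpCutObservablesZd_mono N hmn hb)
  · exact Or.inr ⟨i, j, hij, F, wordSpace_mono _ subset_rfl hmn hF, rfl⟩

/-- Polynomial. -/
theorem kzCutObservablesZdAll_subset_polyAlgebra :
    ∀ b ∈ kzCutObservablesZdAll d N, b ∈ polyAlgebra (ι := ZdEdge d) (fundamentalLatticeRep N) := by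
  rintro b hb
  obtain ⟨n, hn⟩ := Set.mem_iUnion.1 hb
  rcases hn with hb' | ⟨i, j, -, F, hF, rfl⟩
  · exact rpCutObservablesZdAll_subset_polyAlgebra N b (Set.mem_iUnion.2 ⟨n, hb'⟩)
  · have hFp := mem_polyAlgebra_of_mem_wordSpace (fundamentalLatticeRep N) hF
    refine (polyAlgebra _).mul_mem ?_ hFp
    exact comp_relabelCM_mem_polyAlgebra _ _ hFp

/-- A functional with all three cut families at degree `n` is non-negative on the degree-`n` cut
observables. -/
theorem nonneg_of_mem_kzCutObservablesZd {n : ℕ}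
    {φ : C(LGConfig d (Matrix.specialUnitaryGroup (Fin N) ℂ), ℝ) →ₗ[ℝ] ℝ}
    (hsite : IsSiteRPCutFunctional (fundamentalLatticeRep N) n φ)
    (hlink : IsLinkRPCutFunctional (fundamentalLatticeRep N) n φ)
    (hdiag : IsDiagRPCutFunctional (fundamentalLatticeRep N) n φ) :
    ∀ b ∈ kzCutObservablesZd (d := d) N n, 0 ≤ φ b := by
  rintro b (hb | ⟨i, j, hij, F, hF, rfl⟩)
  · exact nonneg_of_mem_rpCutObservablesZd N hsite hlink b hb
  · exact hdiag i j hij F hF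

/-- **A Class-B state assembled from its properties**: a DLR state invariant under translations,
axis permutations and axis reflections, reflection positive for the three mirror families. -/
def ClassBState.ofProperties [T2Space (Matrix.specialUnitaryGroup (Fin N) ℂ)]
    [SecondCountableTopology (Matrix.specialUnitaryGroup (Fin N) ℂ)]
    {μ : Measure (LGConfig d (Matrix.specialUnitaryGroup (Fin N) ℂ))}
    (hμ : μ ∈ ymGibbsMeasures (d := d) (fundamentalRep (Fin N)) β) (hT : IsZdTranslationInvariant μ)
    (hperm : ∀ σ : Equiv.Perm (Fin d), μ.map (relabelConfig (edgePerm σ)) = μ)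
    (hrefl : ∀ i : Fin d, μ.map (configSiteReflect i) = μ)
    (hsite : ∀ i : Fin d, IsReflectionPositiveFor (configSiteReflect (G := Matrix.specialUnitaryGroup (Fin N) ℂ) i)
      (siteHalfEdges i) μ)
    (hlink : ∀ i : Fin d, IsReflectionPositiveFor (configLinkReflect (G := Matrix.specialUnitaryGroup (Fin N) ℂ) i)
      (linkHalfEdges i) μ)
    (hdiag : ∀ i j : Fin d, i ≠ j →
      IsReflectionPositiveFor (configDiagSwapZd (G := Matrix.specialUnitaryGroup (Fin N) ℂ) i j) (diagHalfEdges i j) μ) :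
    ClassBState d (fundamentalRep (Fin N)) β where
  μ := μ
  isProbabilityMeasure := hμ.1
  translationInvariant := hT
  permInvariant σ := by
    refine ⟨?_, ?_⟩
    · rw [configPerm_eq_configPermZd]
      exact (Literature.MathematicalPhysics.QuantumFieldTheory.configPermZd σ).measurable
    · have he : (configPerm σ : LGConfig d (Matrix.specialUnitaryGroup (Fin N) ℂ) → _) =
          relabelConfig (edgePerm σ) := funext (configPerm_eq_relabelConfig_edgePerm N σ)
      rw [he]
      exact hperm σ
  reflectInvariant i := ⟨measurable_configSiteReflect i, hrefl i⟩
  haarShift := isHaarShiftState_of_mem_ymGibbsMeasures (fundamentalRep (Fin N)) (continuous_fundamentalRep _) hμ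
  siteRP := hsite
  linkRP := hlink
  diagRP := hdiag

/-- ★★★ **The complete KZ SDP converges to the Class-B states.** `SU(N)` on `ℤ^d`, any real `β`: for
every polynomial observable `P` and `ε > 0` there is a level `n` such that every value of the
complete level-`n` SDP (loop equations, positivity, full lattice symmetry, site + link + diagonal RP
cuts) lies within `ε` of `∫ P dω.μ` for some Class-B state `ω`. [folklore] -/
theorem kzBootstrap_convergence_classB_suN
    {P : C(LGConfig d (Matrix.specialUnitaryGroup (Fin N) ℂ), ℝ)}
    (hP : P ∈ polyAlgebra (ι := ZdEdge d) (fundamentalLatticeRep N)) {ε : ℝ} (hε : 0 < ε) :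
    ∃ n, ∀ t ∈ kzLevelValuesZdSuN (d := d) N β n P,
      ∃ ω : ClassBState d (fundamentalRep (Fin N)) β, |t - ∫ U, P U ∂ω.μ| ≤ ε := by
  haveI : SecondCountableTopology (Matrix (Fin N) (Fin N) ℂ) :=
    inferInstanceAs (SecondCountableTopology (Fin N → Fin N → ℂ))
  haveI : SecondCountableTopology (Matrix.specialUnitaryGroup (Fin N) ℂ) :=
    Topology.IsEmbedding.subtypeVal.secondCountableTopology
  obtain ⟨n, hn⟩ := bootstrap_convergence_constrained (fundamentalLatticeRep N) (suExp_add N)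
    (X := fun X : SuGenerator N => (X : Matrix (Fin N) (Fin N) ℂ)) (rho_suExp N)
    (S := fun e => wilsonBoundaryAction (fundamentalRep (Fin N)) {e}) (β := β)
    (fun e => wilsonBoundaryAction_mem_polyFunctions (fundamentalLatticeRep N) {e})
    (fun n => wordTruncation (ι := ZdEdge d) (fundamentalLatticeRep N) n)
    (fun a ha => eventually_mem_wordTruncation (fundamentalLatticeRep N) ha)
    (fullSpaceGroupMaps d N)
    (fun R hR a ha => comp_mem_polyAlgebra_of_mem_fullSpaceGroupMaps N hR ha)
    (fun n => kzCutObservablesZd (d := d) N n) (kzCutObservablesZdAll d N)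
    (kzCutObservablesZdAll_subset_polyAlgebra N)
    (fun b hb => by
      obtain ⟨m, hm⟩ := Set.mem_iUnion.1 hb
      exact eventually_atTop.2 ⟨m, fun n hmn => kzCutObservablesZd_mono N hmn hm⟩)
    hP hε
  refine ⟨n, ?_⟩
  rintro t ⟨φ, hφ, hT, hperm, hrefl, hsite, hlink, hdiag, rfl⟩
  obtain ⟨ψ, hψ, hψinv, hψcut, hclose⟩ := hn φ hφ (by
    rintro R ((⟨v, rfl⟩ | ⟨σ, rfl⟩) | ⟨i, rfl⟩) a ha
    · exact hT v a (wordTruncation_mono _ (Nat.le_add_right n n) ha)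
    · exact hperm σ a (wordTruncation_mono _ (Nat.le_add_right n n) ha)
    · exact hrefl i a (wordTruncation_mono _ (Nat.le_add_right n n) ha))
    (nonneg_of_mem_kzCutObservablesZd N hsite hlink hdiag)
  obtain ⟨μ, hμ, hψμ⟩ := exists_dlr_of_bootstrap_suN N β hψ.1 hψ.2.1 hψ.2.2
  haveI := hμ.1
  have hmom : ∀ R, R ∈ fullSpaceGroupMaps d N →
      ∀ a ∈ polyAlgebra (ι := ZdEdge d) (fundamentalLatticeRep N), ∫ U, a (R U) ∂μ = ∫ U, a U ∂μ := by
    intro R hR a ha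
    have h2 := hψμ _ (comp_mem_polyAlgebra_of_mem_fullSpaceGroupMaps N hR ha)
    simp only [ContinuousMap.comp_apply] at h2
    rw [← h2, ← hψμ a ha]
    exact hψinv R hR a ha
  have hTμ : IsZdTranslationInvariant μ :=
    isZdTranslationInvariant_of_forall_poly N (fun v a ha => hmom _ (Or.inl (Or.inl ⟨v, rfl⟩)) a ha)
  have hpermμ : ∀ σ : Equiv.Perm (Fin d), μ.map (relabelConfig (edgePerm σ)) = μ :=
    isAxisPermInvariant_of_forall_poly N (fun σ a ha => hmom _ (Or.inl (Or.inr ⟨σ, rfl⟩)) a ha)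
  have hreflμ : ∀ i : Fin d, μ.map (configSiteReflect i) = μ :=
    isSiteReflectInvariant_of_forall_poly N fun i a ha => by
      have h := hmom _ (Or.inr ⟨i, rfl⟩) a ha
      simp only [zdSiteReflectCM_apply] at h
      exact h
  have hcutμ : ∀ b ∈ kzCutObservablesZdAll d N, 0 ≤ ∫ U, b U ∂μ := fun b hb => by
    rw [← hψμ b (kzCutObservablesZdAll_subset_polyAlgebra N b hb)]
    exact hψcut b hb
  -- site RP
  have hsiteμ : ∀ i : Fin d, IsReflectionPositiveFor
      (configSiteReflect (G := Matrix.specialUnitaryGroup (Fin N) ℂ) i) (siteHalfEdges i) μ := fun i => by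
    have hmp : MeasurePreserving (zdSiteReflectCM (G := Matrix.specialUnitaryGroup (Fin N) ℂ) i) μ μ := by
      refine ⟨by rw [coe_zdSiteReflectCM]; exact measurable_configSiteReflect i, ?_⟩
      rw [coe_zdSiteReflectCM]
      exact hreflμ i
    have h := IsReflectionPositiveFor.of_wordSpace (fundamentalLatticeRep N) (S := siteHalfEdges i)
      (zdSiteReflectCM (G := Matrix.specialUnitaryGroup (Fin N) ℂ) i) hmp (zdSiteReflectCM_zdSiteReflectCM i)
      fun m F hF => by
        have hb : F.comp (zdSiteReflectCM (G := Matrix.specialUnitaryGroup (Fin N) ℂ) i) * F ∈ kzCutObservablesZdAll d N :=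
          Set.mem_iUnion.2 ⟨m, Or.inl (Or.inl ⟨i, F, hF, rfl⟩)⟩
        simpa only [ContinuousMap.mul_apply, ContinuousMap.comp_apply] using hcutμ _ hb
    rwa [coe_zdSiteReflectCM] at h
  -- link RP
  have hlinkμ : ∀ i : Fin d, IsReflectionPositiveFor
      (configLinkReflect (G := Matrix.specialUnitaryGroup (Fin N) ℂ) i) (linkHalfEdges i) μ := fun i => by
    have hcoe : ⇑(zdLinkReflectCM (G := Matrix.specialUnitaryGroup (Fin N) ℂ) i) =
        (configLinkReflect i : LGConfig d (Matrix.specialUnitaryGroup (Fin N) ℂ) → _) :=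
      funext (zdLinkReflectCM_apply i)
    have hmp : MeasurePreserving (zdLinkReflectCM (G := Matrix.specialUnitaryGroup (Fin N) ℂ) i) μ μ := by
      refine ⟨by rw [hcoe]; exact measurable_configLinkReflect i, ?_⟩
      rw [hcoe]
      exact map_configLinkReflect_eq_of_invariant N hTμ (hreflμ i)
    have h := IsReflectionPositiveFor.of_wordSpace (fundamentalLatticeRep N) (S := linkHalfEdges i)
      (zdLinkReflectCM (G := Matrix.specialUnitaryGroup (Fin N) ℂ) i) hmp
      (fun U => by rw [zdLinkReflectCM_apply, zdLinkReflectCM_apply, configLinkReflect_configLinkReflect])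
      fun m F hF => by
        have hb : F.comp (zdLinkReflectCM (G := Matrix.specialUnitaryGroup (Fin N) ℂ) i) * F ∈ kzCutObservablesZdAll d N :=
          Set.mem_iUnion.2 ⟨m, Or.inl (Or.inr ⟨i, F, hF, rfl⟩)⟩
        simpa only [ContinuousMap.mul_apply, ContinuousMap.comp_apply] using hcutμ _ hb
    rwa [hcoe] at h
  -- diagonal RP
  have hdiagμ : ∀ i j : Fin d, i ≠ j → IsReflectionPositiveFor
      (configDiagSwapZd (G := Matrix.specialUnitaryGroup (Fin N) ℂ) i j) (diagHalfEdges i j) μ := fun i j hij => by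
    have hcoe : ⇑(zdDiagSwapCM (G := Matrix.specialUnitaryGroup (Fin N) ℂ) i j) =
        (configDiagSwapZd i j : LGConfig d (Matrix.specialUnitaryGroup (Fin N) ℂ) → _) :=
      funext (zdDiagSwapCM_apply i j)
    have hmp : MeasurePreserving (zdDiagSwapCM (G := Matrix.specialUnitaryGroup (Fin N) ℂ) i j) μ μ := by
      refine ⟨by rw [hcoe]; exact measurable_pi_lambda _ fun _ => measurable_pi_apply _, ?_⟩
      rw [hcoe]
      exact map_configDiagSwapZd_eq_of_invariant N hpermμ i j
    have h := IsReflectionPositiveFor.of_wordSpace (fundamentalLatticeRep N) (S := diagHalfEdges i j)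
      (zdDiagSwapCM (G := Matrix.specialUnitaryGroup (Fin N) ℂ) i j) hmp
      (fun U => by rw [zdDiagSwapCM_apply, zdDiagSwapCM_apply, configDiagSwapZd_configDiagSwapZd])
      fun m F hF => by
        have hb : F.comp (zdDiagSwapCM (G := Matrix.specialUnitaryGroup (Fin N) ℂ) i j) * F ∈ kzCutObservablesZdAll d N :=
          Set.mem_iUnion.2 ⟨m, Or.inr ⟨i, j, hij, F, hF, rfl⟩⟩
        simpa only [ContinuousMap.mul_apply, ContinuousMap.comp_apply] using hcutμ _ hb
    rwa [hcoe] at h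
  refine ⟨ClassBState.ofProperties N β hμ hTμ hpermμ hreflμ hsiteμ hlinkμ hdiagμ, ?_⟩
  change |φ P - ∫ U, P U ∂μ| ≤ ε
  rwa [hψμ P hP] at hclose

/-- ★★★ **Hausdorff form: the complete KZ hierarchy converges to EXACTLY the range of `P` over the
Class-B states** (`ClassBState.integral_mem_kzLevelValuesZd` for the other inclusion). -/
theorem kzLevelValuesZd_hausdorff_suN
    {P : C(LGConfig d (Matrix.specialUnitaryGroup (Fin N) ℂ), ℝ)}
    (hP : P ∈ polyAlgebra (ι := ZdEdge d) (fundamentalLatticeRep N)) {ε : ℝ} (hε : 0 < ε) :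
    ∃ n, (∀ t ∈ kzLevelValuesZdSuN (d := d) N β n P,
        ∃ ω : ClassBState d (fundamentalRep (Fin N)) β, |t - ∫ U, P U ∂ω.μ| ≤ ε) ∧
      ∀ ω : ClassBState d (fundamentalRep (Fin N)) β, ∫ U, P U ∂ω.μ ∈ kzLevelValuesZdSuN (d := d) N β n P := by
  obtain ⟨n, hn⟩ := kzBootstrap_convergence_classB_suN N β hP hε
  exact ⟨n, hn, fun ω => ω.integral_mem_kzLevelValuesZd N β n P⟩

/-! ### Infeasibility where Class B is empty -/

/-- ★★★ **If Class B is empty at `β`, the complete KZ SDP is infeasible at all large levels**: there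
is a level `n` from which on `kzLevelValuesZdSuN N β m P = ∅` for EVERY objective `P`. [folklore] -/
theorem kzLevelValuesZd_eventually_empty_of_isEmpty (h : IsEmpty (ClassBState d (fundamentalRep (Fin N)) β)) :
    ∃ n, ∀ m, n ≤ m → ∀ P : C(LGConfig d (Matrix.specialUnitaryGroup (Fin N) ℂ), ℝ),
      kzLevelValuesZdSuN (d := d) N β m P = ∅ := by
  obtain ⟨n, hn⟩ := kzBootstrap_convergence_classB_suN (d := d) N β
    (P := 1) (polyAlgebra (ι := ZdEdge d) (fundamentalLatticeRep N)).one_mem one_pos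
  refine ⟨n, fun m hmn P => Set.eq_empty_iff_forall_notMem.2 fun t ht => ?_⟩
  obtain ⟨φ, hφ, hT, hperm, hrefl, hsite, hlink, hdiag, -⟩ := ht
  have h1 : φ 1 ∈ kzLevelValuesZdSuN (d := d) N β n 1 :=
    kzLevelValuesZd_anti N β hmn 1 ⟨φ, hφ, hT, hperm, hrefl, hsite, hlink, hdiag, rfl⟩
  obtain ⟨ω, -⟩ := hn _ h1
  exact h.false ω

/-- ★★★ **`SU(N)`, `N ≥ 2`, `d ≥ 2`, `β < 0`: Kazakov–Zheng's complete infinite-lattice SDP (with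
the diagonal reflection-positivity cuts) has no feasible point at any sufficiently high level** —
Class B is empty there (`isEmpty_classBState_of_neg_suN`: translation invariance, the one-link Gibbs
identity and diagonal RP are incompatible at negative coupling). [folklore] -/
theorem kzLevelValuesZd_eventually_empty_of_neg_suN (hd : 2 ≤ d) (hN : 2 ≤ N) (hβ : β < 0) :
    ∃ n, ∀ m, n ≤ m → ∀ P : C(LGConfig d (Matrix.specialUnitaryGroup (Fin N) ℂ), ℝ),
      kzLevelValuesZdSuN (d := d) N β m P = ∅ :=
  kzLevelValuesZd_eventually_empty_of_isEmpty N β (isEmpty_classBState_of_neg_suN hd hN hβ)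

/-- ★★ **Conversely, where Class B is inhabited the complete SDP is feasible at every level.** -/
theorem kzLevelValuesZd_nonempty_of_nonempty (h : Nonempty (ClassBState d (fundamentalRep (Fin N)) β)) (n : ℕ)
    (P : C(LGConfig d (Matrix.specialUnitaryGroup (Fin N) ℂ), ℝ)) :
    (kzLevelValuesZdSuN (d := d) N β n P).Nonempty := by
  obtain ⟨ω⟩ := h
  exact ⟨_, ω.integral_mem_kzLevelValuesZd N β n P⟩

/-- ★★ **The complete SDP is feasible at every level iff Class B is inhabited.** -/
theorem forall_kzLevelValuesZd_nonempty_iff :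
    (∀ (n : ℕ) (P : C(LGConfig d (Matrix.specialUnitaryGroup (Fin N) ℂ), ℝ)),
        (kzLevelValuesZdSuN (d := d) N β n P).Nonempty) ↔
      Nonempty (ClassBState d (fundamentalRep (Fin N)) β) := by
  constructor
  · intro h
    by_contra hne
    rw [not_nonempty_iff] at hne
    obtain ⟨n, hn⟩ := kzLevelValuesZd_eventually_empty_of_isEmpty N β hne
    have h1 := h n 1
    rw [hn n le_rfl 1] at h1
    exact Set.not_nonempty_empty h1
  · exact fun h n P => kzLevelValuesZd_nonempty_of_nonempty N β h n P

end ZdSuN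

end Summit.QuantumFields.GaugeBoot

end
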